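import Summits.AtomisticToContinuum.HydrodynamicLimit.Theorems.InformationPercolationEngineChaosClosesEulerPressureValueN
import Summits.AtomisticToContinuum.HydrodynamicLimit.Theorems.InformationPercolationEngineKineticClosureBridge
import HarnessLib

/-!
# Collisional pressure value in band (crux `ChaosClosesEuler`, stmt-AtomisticToContinuum-15141, line `Sketch`,
# stub `stub_pressureValueOfEnskog`) — helper O: the estimate in probability at fixed `(σ, t)`

WHAT. `pressureValue_inProbability`: from the Maxwellian moments, pointwise local equilibrium at `(σ, t)` (band
`ηP`), the pointwise Enskog collision statistics at `σ` for density weights (band `ηE`), the cubic velocity tails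
at `t` and the quadratic collision-moment uniform integrability at `σ` (hypotheses in the formats of the skeleton;
cone fields = the tree's `rhoC, uC, thetaC, MpsiC`, windowed statistics = the tree's `collisionSum`,
`pairFunctional`): `P_N(η < |K_t[g |⟪v⁻ᵢ−v⁻ⱼ,n̂⟫| Σ a_kl n̂ₖn̂ₗ] − 2∫₀ᵗ∫ g(σ³ρ_r) p_ex tr a|) ≤ δ` eventually.
Tolerances in the order `δ/23`; `K`; `εC, εP, εPl, θ₁, κ, η'`; `M₀, L_C`, `L`; `Θ, U, ρ₁`; the twenty tests; the
modulus scale `d` at tolerance `ω`; `r₀`, `N₀`.  Off a null set and `23` bad events: bridging (helper N), the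
pathwise core (helper M), the budget (helper N).

References: P. Résibois, M. De Leener (1977) Ch. VI §3; H. van Beijeren, M. H. Ernst, Physica 68 (1973).
-/

noncomputable section

namespace Summit.AtomisticToContinuum.HydrodynamicLimit.Theorems.ChaosClosesEulerPressureValue

open scoped BigOperators Topology Classical MeasureTheory ENNReal InnerProductSpace
open Filter Set MeasureTheory
open Literature.MathematicalPhysics.KineticTheory
open Literature.Analysis.FluidPDE
open Summit.AtomisticToContinuum.HydrodynamicLimit.Theorems.LocalSecondLawNegative
open Summit.AtomisticToContinuum.HydrodynamicLimit.Theorems.LocalSecondLawLedger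
open Summit.AtomisticToContinuum.HydrodynamicLimit.Theorems.LocalSecondLawLedger.L
  (Mmom rhoC_eq_sum momC_apply_eq_sum momC_eq_sum kinC_eq_trace norm_sq_eq_sum)

/-- The truncated stress mark `𝒯[L,k,l]` (local notation for an explicit lambda). -/
local notation3 "𝒯[" L ", " k ", " l "]" => fun q : V3 × V3 × V3 =>
  min |⟪q.2.1 - q.2.2, q.1⟫_ℝ| (4 * L) * (speedCutoff L ‖q.2.1‖ * speedCutoff L ‖q.2.2‖) * (clip1 (q.1 k) * clip1 (q.1 l))

/-- The dominating mark `ℬ[L]` (local notation for an explicit lambda). -/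
local notation3 "ℬ[" L "]" => fun q : V3 × V3 × V3 => 4 * L * (speedCutoff L ‖q.2.1‖ * speedCutoff L ‖q.2.2‖)

section InProbability

open Function
open Summit.AtomisticToContinuum.HydrodynamicLimit.Theorems.ChaosClosesEulerStressIsotropy

variable {σ : ℝ} {N : ℕ}

/-- **THE COLLISIONAL PRESSURE VALUE IN BAND, IN PROBABILITY, AT FIXED `(σ, t)`.** See the module docstring.
[folklore] -/
theorem pressureValue_inProbability
    (hMM : ∀ (ρ θ : ℝ) (u : V3), 0 < ρ → 0 < θ →
      let m : Measure V3 := volume.withDensity (fun v => ENNReal.ofReal (localMaxwellian ρ θ u v))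
      IsFiniteMeasure m ∧ Integrable (fun v : V3 => ‖v‖ ^ 2) m ∧
      (m Set.univ).toReal = ρ ∧ (∀ j : Fin 3, ∫ v, v j ∂m = ρ * u j) ∧
      (∀ j k : Fin 3, ∫ v, v j * v k ∂m = ρ * (u j * u k + if j = k then θ else 0)) ∧
      (∫ v, ‖v‖ ^ 2 ∂m = ρ * (‖u‖ ^ 2 + 3 * θ)) ∧
      (∀ ψ : V3 → ℝ, Continuous ψ → (∃ C : ℝ, ∀ v, |ψ v| ≤ C) →
        Integrable ψ m ∧ ∫ v, ψ v ∂m = ρ * ∫ v, ψ v * localMaxwellian 1 θ u v))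
    {σ : ℝ} (hσ : 0 < σ) (hσ2 : σ ≤ 1 / 2) {a₀ θ₀ : T3 → ℝ} {u₀ : T3 → V3} (ha : Continuous a₀)
    (hθc : Continuous θ₀) (hu : Continuous u₀) (ha0 : ∀ x, 0 < a₀ x) (hθ0 : ∀ x, 0 < θ₀ x)
    (Φ : (N : ℕ) → HardSphereFlow (Torus.geometry (Fin 3)) (hsDiameter σ N) (N + 1)) {t : ℝ} (ht : 0 ≤ t)
    {η₀ ηP ηE ηY : ℝ} (hη₀ : 0 < η₀) (hη₀P : η₀ ≤ ηP) (hη₀E : η₀ ≤ ηE) (hη₀Y : η₀ ≤ ηY)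
    {Yt : ℝ → ℝ} (hYt : Continuous Yt) (hYeq : ∀ b, 0 < b → b ≤ ηY → Yt b = contactValue b)
    (hPLE : ∀ ψ : V3 → ℝ, Continuous ψ → (∃ C : ℝ, ∀ v, |ψ v| ≤ C) →
      ∀ h : ℝ × V3 × ℝ → ℝ, Continuous h → (∃ C : ℝ, ∀ p, |h p| ≤ C) →
      (∃ ρ₁ θ₁ Θ U : ℝ, 0 < ρ₁ ∧ 0 < θ₁ ∧ ∀ p : ℝ × V3 × ℝ,
        (p.1 ≤ ρ₁ ∨ ηP ≤ σ ^ 3 * p.1 ∨ p.2.2 ≤ θ₁ ∨ Θ ≤ p.2.2 ∨ U ≤ ‖p.2.1‖) → h p = 0) →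
      ∀ η δ : ℝ, 0 < η → 0 < δ → ∃ r₀ : ℝ, 0 < r₀ ∧ ∀ r : ℝ, 0 < r → r < r₀ → ∃ N₀ : ℕ, ∀ N : ℕ, N₀ ≤ N →
      localGibbsLaw σ a₀ u₀ θ₀ N (Φ N)
        {z | η < ∫ s in Set.Icc 0 t, ∫ x,
          |h (rhoC r ((Φ N).flow s z) x, uC r ((Φ N).flow s z) x, thetaC r ((Φ N).flow s z) x)| *
            |MpsiC r ((Φ N).flow s z) x ψ - rhoC r ((Φ N).flow s z) x *
              ∫ v, ψ v * localMaxwellian 1 (thetaC r ((Φ N).flow s z) x) (uC r ((Φ N).flow s z) x) v|} ≤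
          ENNReal.ofReal δ)
    (hPEC : ∀ τ : ℝ, 0 < τ → ∀ G : V3 × V3 × V3 → ℝ, Continuous G → (∃ C : ℝ, ∀ p, |G p| ≤ C) →
      ∀ k : ℝ → ℝ, Continuous k → (∃ C : ℝ, ∀ b, |k b| ≤ C) → (∀ b, ηE ≤ b → k b = 0) →
      ∀ η δ : ℝ, 0 < η → 0 < δ → ∃ r₀ : ℝ, 0 < r₀ ∧ ∀ r : ℝ, 0 < r → r < r₀ → ∃ N₀ : ℕ, ∀ N : ℕ, N₀ ≤ N →
      localGibbsLaw σ a₀ u₀ θ₀ N (Φ N)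
        {z | η < ∫ t₀ in Set.Icc 0 τ, ∫ x₀,
          |collisionSum σ N (Φ N) τ (fun p => r⁻¹ * max (1 - |p.1 - t₀| / r) 0 * cone r p.2 x₀) k G r z -
            σ ^ 3 * ∫ s in Set.Icc 0 τ, r⁻¹ * max (1 - |s - t₀| / r) 0 * ∫ x, cone r x x₀ *
              (k (σ ^ 3 * rhoC r ((Φ N).flow s z) x) * contactValue (σ ^ 3 * rhoC r ((Φ N).flow s z) x) *
                pairFunctional r G ((Φ N).flow s z) x)|} ≤ ENNReal.ofReal δ)
    (hECT : ∀ ε : ℝ, 0 < ε → ∃ M : ℝ, ∃ N₀ : ℕ, ∀ N : ℕ, N₀ ≤ N → ∀ s ∈ Set.Icc 0 t,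
      ∫⁻ z, ENNReal.ofReal (((N : ℝ) + 1)⁻¹ * ∑ i : Fin (N + 1),
        Set.indicator {v : V3 | M < ‖v‖} (fun v => ‖v‖ ^ 3) (((Φ N).flow s z i).2))
          ∂(localGibbsLaw σ a₀ u₀ θ₀ N (Φ N)) ≤ ENNReal.ofReal ε)
    (hCM : ∀ τ : ℝ, 0 < τ → ∀ η δ : ℝ, 0 < η → 0 < δ → ∃ L : ℝ, ∃ N₀ : ℕ, ∀ N : ℕ, N₀ ≤ N →
      localGibbsLaw σ a₀ u₀ θ₀ N (Φ N)
        {z | η < hsDiameter σ N / (N + 1 : ℝ) *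
          ∑ᶠ (s : ℝ) (_ : s ∈ collisionTimes (Torus.geometry (Fin 3)) (hsDiameter σ N) (fun s => (Φ N).flow s z) ∩
            Set.Icc 0 τ), ∑ i : Fin (N + 1), ∑ j : Fin (N + 1),
            (if i ≠ j ∧ ‖(Torus.geometry (Fin 3)).sepVec ((Φ N).flow s z i).1 ((Φ N).flow s z j).1‖ = hsDiameter σ N then
              (if L < ‖((Φ N).flow s z i).2‖ ^ 2 + ‖((Φ N).flow s z j).2‖ ^ 2 then
                1 + ‖((Φ N).flow s z i).2‖ ^ 2 + ‖((Φ N).flow s z j).2‖ ^ 2 else 0) else 0)} ≤ ENNReal.ofReal δ)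
    (a : Fin 3 → Fin 3 → ℝ × T3 → ℝ) (hac : ∀ j k, Continuous (a j k))
    (g : ℝ → ℝ) (hgc : Continuous g) (hg0 : ∀ b, η₀ ≤ b → g b = 0) {η δ : ℝ} (hη : 0 < η) (hδ : 0 < δ) :
    ∃ r₀ : ℝ, 0 < r₀ ∧ ∀ r : ℝ, 0 < r → r < r₀ → ∃ N₀ : ℕ, ∀ N : ℕ, N₀ ≤ N →
      localGibbsLaw σ a₀ u₀ θ₀ N (Φ N)
        {z | η < |hsDiameter σ N / (N + 1 : ℝ) *
          (∑ᶠ (s : ℝ) (_ : s ∈ collisionTimes (Torus.geometry (Fin 3)) (hsDiameter σ N) (fun s => (Φ N).flow s z) ∩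
            Set.Icc 0 t), ∑ i : Fin (N + 1), ∑ j : Fin (N + 1),
            (if i ≠ j ∧ ‖(Torus.geometry (Fin 3)).sepVec ((Φ N).flow s z i).1 ((Φ N).flow s z j).1‖ = hsDiameter σ N then
              g (σ ^ 3 * rhoC r ((Φ N).flow s z) ((Φ N).flow s z i).1) *
                |⟪(reflectVel ((Torus.geometry (Fin 3)).sepVec ((Φ N).flow s z i).1 ((Φ N).flow s z j).1)
                    (((Φ N).flow s z i).2, ((Φ N).flow s z j).2)).1 -
                  (reflectVel ((Torus.geometry (Fin 3)).sepVec ((Φ N).flow s z i).1 ((Φ N).flow s z j).1)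
                    (((Φ N).flow s z i).2, ((Φ N).flow s z j).2)).2,
                  (hsDiameter σ N)⁻¹ • (Torus.geometry (Fin 3)).sepVec ((Φ N).flow s z i).1 ((Φ N).flow s z j).1⟫_ℝ| *
                ∑ k : Fin 3, ∑ l : Fin 3, a k l (s, ((Φ N).flow s z i).1) *
                  (((hsDiameter σ N)⁻¹ • (Torus.geometry (Fin 3)).sepVec ((Φ N).flow s z i).1 ((Φ N).flow s z j).1) k *
                    ((hsDiameter σ N)⁻¹ • (Torus.geometry (Fin 3)).sepVec ((Φ N).flow s z i).1 ((Φ N).flow s z j).1) l)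
            else 0)) -
          2 * ∫ s in Set.Icc 0 t, ∫ x, g (σ ^ 3 * rhoC r ((Φ N).flow s z) x) * pexC σ r ((Φ N).flow s z) x *
            ∑ k : Fin 3, a k k (s, x)|} ≤ ENNReal.ofReal δ := by
  obtain ⟨gc, hgcdef⟩ : ∃ gc : ℝ → ℝ, ∀ b, gc b = g (max b 0) := ⟨_, fun _ => rfl⟩
  have hgceq : gc = fun b => g (max b 0) := funext hgcdef
  have hgcc : Continuous gc := by rw [hgceq]; exact hgc.comp (continuous_id.max continuous_const)
  have hgc0 : ∀ b, η₀ ≤ b → gc b = 0 := fun b hb => by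
    rw [hgcdef, max_eq_left (hη₀.le.trans hb)]; exact hg0 b hb
  have hgcnn : ∀ b, 0 ≤ b → gc b = g b := fun b hb => by rw [hgcdef, max_eq_left hb]
  obtain ⟨Gb, hGb0, hGb⟩ := exists_bound_of_vanishing hgc hg0
  have hgb : ∀ b, |gc b| ≤ Gb := fun b => by rw [hgcdef]; exact hGb _ (le_max_right _ _)
  obtain ⟨CgY, hCgY0, hgY⟩ := EvenStressEnskog.exists_bound_mul_contactValue_of_clamp hgcc hYt hYeq hη₀ hη₀Y hgc0
  obtain ⟨hacc, haceq, ⟨A, hA0, hA⟩, hmod⟩ := clampCoeff_facts a hac t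
  have hδ' : 0 < δ / 23 := by positivity
  obtain ⟨K, hK0, hKev⟩ := KineticClosureBridge.exists_energy_tail_le (u₀ := u₀) ha hθc hu ha0 hθ0 hσ2 hδ'
  obtain ⟨εC, hεC⟩ : ∃ εC : ℝ, εC = η / (10 * (9 * (A * Gb) + 1)) := ⟨_, rfl⟩
  obtain ⟨εP, hεP⟩ : ∃ εP : ℝ, εP = η / (10 * (9 * A + 1)) := ⟨_, rfl⟩
  obtain ⟨εPl, hεPl⟩ : ∃ εPl : ℝ, εPl = η / (10 * (18 + 72 * A + 1)) := ⟨_, rfl⟩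
  have hεC0 : 0 < εC := by rw [hεC]; positivity
  have hεP0 : 0 < εP := by rw [hεP]; positivity
  have hεPl0 : 0 < εPl := by rw [hεPl]; positivity
  obtain ⟨θ₁, hθ₁⟩ : ∃ θ₁ : ℝ, θ₁ = η / 10 / (6 * (90 * (CgY * η₀) * (2 * A) * t + 1)) := ⟨_, rfl⟩
  obtain ⟨κ, hκ⟩ : ∃ κ : ℝ, κ = η / 10 / (6 * (48 * (CgY * η₀) * (2 * A) + 1)) := ⟨_, rfl⟩
  obtain ⟨η', hη'⟩ : ∃ η' : ℝ, η' = η / 10 / (6 * (18 * (2 * A) + 1)) := ⟨_, rfl⟩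
  have hθ₁0 : 0 < θ₁ := by rw [hθ₁]; positivity
  have hκ0 : 0 < κ := by rw [hκ]; positivity
  have hη'0 : 0 < η' := by rw [hη']; positivity
  have hεE : 0 < δ / 23 * κ / (t + 1) := by positivity
  obtain ⟨M₀, N₀E, hECT'⟩ := hECT (δ / 23 * κ / (t + 1)) hεE
  obtain ⟨L_C, N₀C, hCM'⟩ := hCM (t + 1) (by linarith) εC (δ / 23) hεC0 hδ'
  obtain ⟨L, hLdef⟩ : ∃ L : ℝ, L = max (max M₀ 1) (max L_C 1) := ⟨_, rfl⟩
  have hL1 : 1 ≤ L := by rw [hLdef]; exact (le_max_right _ _).trans (le_max_left _ _)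
  have hL0 : 0 < L := by linarith
  have hM₀L : M₀ ≤ L := by rw [hLdef]; exact (le_max_left _ _).trans (le_max_left _ _)
  have hLC : L_C ≤ L ^ 2 := by
    have h1 : L_C ≤ L := by rw [hLdef]; exact (le_max_left _ _).trans (le_max_right _ _)
    nlinarith
  obtain ⟨Θ, hΘ⟩ : ∃ Θ : ℝ, Θ = 12 * (45 * (CgY * η₀) * (2 * A) * t * (4 * L ^ 2 / 9) * K) / (η / 10) + 1 := ⟨_, rfl⟩
  obtain ⟨U, hU⟩ : ∃ U : ℝ, U = 12 * (45 * (CgY * η₀) * (2 * A) * t * (8 * L ^ 2 / 3) * K) / (η / 10) + 1 := ⟨_, rfl⟩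
  have hΘ0 : 0 < Θ := by rw [hΘ]; positivity
  have hU0 : 0 < U := by rw [hU]; positivity
  obtain ⟨ρ₁, hρ₁⟩ : ∃ ρ₁ : ℝ, ρ₁ = η / 10 / (6 * (45 * (CgY * η₀) * (2 * A) * t * Θ + 1)) := ⟨_, rfl⟩
  have hρ₁0 : 0 < ρ₁ := by rw [hρ₁]; positivity
  have h6 := stub_stressIsotropyBudget (η := η / 10) (M := L) (by positivity) ht (by positivity : (0 : ℝ) ≤ CgY * η₀)
    (by positivity : (0 : ℝ) ≤ 2 * A) hK0 hθ₁ hΘ hU hρ₁ hκ hη'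
  have hgt : Continuous fun b => gc b * Yt b * b := (hgcc.mul hYt).mul continuous_id
  have hgtb : ∀ b, 0 ≤ b → |gc b * Yt b * b| ≤ CgY * η₀ := fun b hb => by
    have hw := weight_facts hη₀ hgY hgc0 hYeq hη₀Y hb
    rw [← hw.1]; exact hw.2
  obtain ⟨hW, hWh⟩ : ∃ hW : ℝ × V3 × ℝ → ℝ, ∀ p,
      hW p = bulkCut ρ₁ θ₁ Θ U p * (gc (σ ^ 3 * p.1) * Yt (σ ^ 3 * p.1) * (σ ^ 3 * p.1)) := ⟨_, fun _ => rfl⟩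
  have hWc : Continuous hW := continuous_bulkWeight (g := fun b => gc b * Yt b * b) hgt hWh
  have hWb : ∀ p, |hW p| ≤ CgY * η₀ :=
    abs_bulkWeight_le (g := fun b => gc b * Yt b * b) hρ₁0 hθ₁0 hΘ0 hU0 hσ.le (by positivity) hgtb hWh
  have hsupp : ∀ p : ℝ × V3 × ℝ, (p.1 ≤ ρ₁ ∨ ηP ≤ σ ^ 3 * p.1 ∨ p.2.2 ≤ θ₁ ∨ Θ ≤ p.2.2 ∨ U ≤ ‖p.2.1‖) →
      hW p = 0 := by
    intro p hp
    rcases hp with hp | hp | hp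
    · rw [hWh, bulkCut_eq_zero (p := p) hρ₁0 hθ₁0 hΘ0 hU0 (Or.inl hp), zero_mul]
    · rw [hWh, hgc0 _ (hη₀P.trans hp), zero_mul, zero_mul, mul_zero]
    · rw [hWh, bulkCut_eq_zero (p := p) hρ₁0 hθ₁0 hΘ0 hU0 (Or.inr hp), zero_mul]
  have hPJ : ∀ jk : Fin 3 × Fin 3, ∃ r₀ : ℝ, 0 < r₀ ∧ ∀ r : ℝ, 0 < r → r < r₀ → ∃ N₀ : ℕ, ∀ N : ℕ, N₀ ≤ N →
      localGibbsLaw σ a₀ u₀ θ₀ N (Φ N)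
        {z | η' < ∫ s in Set.Icc 0 t, ∫ x,
          |hW (rhoC r ((Φ N).flow s z) x, uC r ((Φ N).flow s z) x, thetaC r ((Φ N).flow s z) x)| *
            |MpsiC r ((Φ N).flow s z) x (psiJK L jk.1 jk.2) - rhoC r ((Φ N).flow s z) x *
              ∫ v, psiJK L jk.1 jk.2 v *
                localMaxwellian 1 (thetaC r ((Φ N).flow s z) x) (uC r ((Φ N).flow s z) x) v|} ≤
          ENNReal.ofReal (δ / 23) := fun jk =>
    hPLE (psiJK L jk.1 jk.2) (continuous_psiJK L jk.1 jk.2) ⟨(L + 1) ^ 2, abs_psiJK_le L jk.1 jk.2⟩ hW hWc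
      ⟨CgY * η₀, hWb⟩ ⟨ρ₁, θ₁, Θ, U, hρ₁0, hθ₁0, hsupp⟩ η' (δ / 23) hη'0 hδ'
  choose rJ hrJ HJ using hPJ
  obtain ⟨rE, hrE, HE⟩ := hPLE (psiE L) (continuous_psiE L) ⟨(L + 1) ^ 2, abs_psiE_le L⟩ hW hWc ⟨CgY * η₀, hWb⟩
    ⟨ρ₁, θ₁, Θ, U, hρ₁0, hθ₁0, hsupp⟩ η' (δ / 23) hη'0 hδ'
  have hgcE : ∀ b, ηE ≤ b → gc b = 0 := fun b hb => hgc0 b (hη₀E.trans hb)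
  have hPK : ∀ kl : Fin 3 × Fin 3, ∃ r₀ : ℝ, 0 < r₀ ∧ ∀ r : ℝ, 0 < r → r < r₀ → ∃ N₀ : ℕ, ∀ N : ℕ, N₀ ≤ N →
      localGibbsLaw σ a₀ u₀ θ₀ N (Φ N)
        {z | εP < ∫ t₀ in Set.Icc 0 (t + 1), ∫ x₀,
          |collisionSum σ N (Φ N) (t + 1) (fun p => r⁻¹ * max (1 - |p.1 - t₀| / r) 0 * cone r p.2 x₀) gc
              𝒯[L, kl.1, kl.2] r z -
            σ ^ 3 * ∫ s in Set.Icc 0 (t + 1), r⁻¹ * max (1 - |s - t₀| / r) 0 * ∫ x, cone r x x₀ *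
              (gc (σ ^ 3 * rhoC r ((Φ N).flow s z) x) * contactValue (σ ^ 3 * rhoC r ((Φ N).flow s z) x) *
                pairFunctional r 𝒯[L, kl.1, kl.2] ((Φ N).flow s z) x)|} ≤ ENNReal.ofReal (δ / 23) := fun kl =>
    hPEC (t + 1) (by linarith) 𝒯[L, kl.1, kl.2] (continuous_markT L kl.1 kl.2) ⟨4 * L, abs_markT_le hL0 kl.1 kl.2⟩
      gc hgcc ⟨Gb, hgb⟩ hgcE εP (δ / 23) hεP0 hδ'
  choose rK hrK HK using hPK
  obtain ⟨rL, hrL, HL⟩ := hPEC (t + 1) (by linarith) ℬ[L] (continuous_markB L)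
    ⟨4 * L, fun q => by rw [abs_of_nonneg (markB_nonneg hL0 q)]; exact markB_le hL0 q⟩
    (fun b => |gc b|) hgcc.abs ⟨Gb, fun b => by rw [abs_abs]; exact hgb b⟩
    (fun b hb => by simp only [hgcE b hb, abs_zero]) εPl (δ / 23) hεPl0 hδ'
  obtain ⟨ω, hωdef⟩ : ∃ ω : ℝ, ω = min 1 (min (η / (10 * (18 * (t + 2) * (16 * Real.pi * L ^ 2 * CgY * η₀) + 1)))
      (η / (20 * (9 * (CgY * (8 * Real.pi / 5) * η₀ * K * (t + 1)) + 1)))) := ⟨_, rfl⟩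
  have hω0 : 0 < ω := by rw [hωdef]; exact lt_min one_pos (lt_min (by positivity) (by positivity))
  have hω1 : ω ≤ 1 := by rw [hωdef]; exact min_le_left _ _
  have hωb : ω ≤ η / (10 * (18 * (t + 2) * (16 * Real.pi * L ^ 2 * CgY * η₀) + 1)) := by
    rw [hωdef]; exact (min_le_right _ _).trans (min_le_left _ _)
  have hωb' : ω ≤ η / (20 * (9 * (CgY * (8 * Real.pi / 5) * η₀ * K * (t + 1)) + 1)) := by
    rw [hωdef]; exact (min_le_right _ _).trans (min_le_right _ _)
  obtain ⟨d, hd0, hd⟩ := hmod ω hω0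
  obtain ⟨rb, hrbdef⟩ : ∃ rb : ℝ, rb = min (η / (20 * (324 * A * (16 * Real.pi * L ^ 2 * CgY * η₀) + 1)))
      (η / (20 * (54 * A * (CgY * (8 * Real.pi / 5) * η₀ * K) + 1))) := ⟨_, rfl⟩
  have hrb0 : 0 < rb := by rw [hrbdef]; exact lt_min (by positivity) (by positivity)
  refine ⟨min (min (Finset.univ.inf' Finset.univ_nonempty rJ) (min rE (Finset.univ.inf' Finset.univ_nonempty rK)))
      (min (min rL d) (min rb (1 / 2))),
    lt_min (lt_min ((Finset.lt_inf'_iff _).2 fun jk _ => hrJ jk)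
      (lt_min hrE ((Finset.lt_inf'_iff _).2 fun kl _ => hrK kl)))
      (lt_min (lt_min hrL hd0) (lt_min hrb0 (by norm_num))), fun r hr hrr₀ => ?_⟩
  have hrJ' : ∀ jk, r < rJ jk := fun jk =>
    hrr₀.trans_le (((min_le_left _ _).trans (min_le_left _ _)).trans (Finset.inf'_le _ (Finset.mem_univ jk)))
  have hrE' : r < rE := hrr₀.trans_le (((min_le_left _ _).trans (min_le_right _ _)).trans (min_le_left _ _))
  have hrK' : ∀ kl, r < rK kl := fun kl =>
    hrr₀.trans_le ((((min_le_left _ _).trans (min_le_right _ _)).trans (min_le_right _ _)).trans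
      (Finset.inf'_le _ (Finset.mem_univ kl)))
  have hrL' : r < rL := hrr₀.trans_le (((min_le_right _ _).trans (min_le_left _ _)).trans (min_le_left _ _))
  have hrd : r < d := hrr₀.trans_le (((min_le_right _ _).trans (min_le_left _ _)).trans (min_le_right _ _))
  have hrrb : r < rb := hrr₀.trans_le (((min_le_right _ _).trans (min_le_right _ _)).trans (min_le_left _ _))
  have hrb : r ≤ η / (20 * (324 * A * (16 * Real.pi * L ^ 2 * CgY * η₀) + 1)) :=
    (hrrb.trans_le (by rw [hrbdef]; exact min_le_left _ _)).le
  have hrb' : r ≤ η / (20 * (54 * A * (CgY * (8 * Real.pi / 5) * η₀ * K) + 1)) :=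
    (hrrb.trans_le (by rw [hrbdef]; exact min_le_right _ _)).le
  have hr2 : r < 1 / 2 := hrr₀.trans_le (((min_le_right _ _).trans (min_le_right _ _)).trans (min_le_right _ _))
  choose NJ HNJ using fun jk => HJ jk r hr (hrJ' jk)
  obtain ⟨NE, HNE⟩ := HE r hr hrE'
  choose NK HNK using fun kl => HK kl r hr (hrK' kl)
  obtain ⟨NL, HNL⟩ := HL r hr hrL'
  refine ⟨max (max (Finset.univ.sup' Finset.univ_nonempty NJ) (max NE N₀E))
    (max (max (Finset.univ.sup' Finset.univ_nonempty NK) NL) N₀C), fun N hN => ?_⟩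
  have hNJ : ∀ jk, NJ jk ≤ N := fun jk =>
    le_trans (((Finset.le_sup' NJ (Finset.mem_univ jk)).trans (le_max_left _ _)).trans (le_max_left _ _)) hN
  have hNE : NE ≤ N := le_trans (((le_max_left _ _).trans (le_max_right _ _)).trans (le_max_left _ _)) hN
  have hN₀E : N₀E ≤ N := le_trans (((le_max_right _ _).trans (le_max_right _ _)).trans (le_max_left _ _)) hN
  have hNK : ∀ kl, NK kl ≤ N := fun kl =>
    le_trans ((((Finset.le_sup' NK (Finset.mem_univ kl)).trans (le_max_left _ _)).trans (le_max_left _ _)).trans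
      (le_max_right _ _)) hN
  have hNL : NL ≤ N := le_trans ((((le_max_right _ _).trans (le_max_left _ _))).trans (le_max_right _ _)) hN
  have hN₀C : N₀C ≤ N := le_trans ((le_max_right _ _).trans (le_max_right _ _)) hN
  haveI : IsProbabilityMeasure (localGibbsLaw σ a₀ u₀ θ₀ N (Φ N)) :=
    isProbabilityMeasure_localGibbsLaw ha hθc hu ha0 hθ0 hσ2 N (Φ N)
  have hStail : localGibbsLaw σ a₀ u₀ θ₀ N (Φ N)
      {z | κ < ∫ s in (0 : ℝ)..t, ((N : ℝ) + 1)⁻¹ * ∑ i, cubeTail L (((Φ N).flow s z) i).2} ≤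
      ENNReal.ofReal (δ / 23) := by
    refine (cubeTail_window_event_le (Φ N) (localGibbsLaw_compl_good_eq_zero (Φ N)) ht hM₀L hεE.le hκ0
      (hECT' N hN₀E)).trans (ENNReal.ofReal_le_ofReal ?_)
    have h3 : t * (δ / 23 * κ / (t + 1)) / κ = t * (δ / 23 / (t + 1)) := by
      rw [mul_div_assoc]
      congr 1
      field_simp
    rw [h3]
    exact mul_div_add_one_le ht hδ'.le
  have hSen : localGibbsLaw σ a₀ u₀ θ₀ N (Φ N) {z | K < ((N : ℝ) + 1)⁻¹ * configEnergy ((Φ N).flow 0 z)} ≤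
      ENNReal.ofReal (δ / 23) := hKev N (Φ N) 0
  have hSE := HNE N hNE
  refine (measure_le_of_cover (localGibbsLaw σ a₀ u₀ θ₀ N (Φ N))
    (S := Sum.elim
      (fun jk : Fin 3 × Fin 3 => {z : Phase N | η' < ∫ s in Set.Icc 0 t, ∫ x,
        |hW (rhoC r ((Φ N).flow s z) x, uC r ((Φ N).flow s z) x, thetaC r ((Φ N).flow s z) x)| *
          |MpsiC r ((Φ N).flow s z) x (psiJK L jk.1 jk.2) - rhoC r ((Φ N).flow s z) x *
            ∫ v, psiJK L jk.1 jk.2 v *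
              localMaxwellian 1 (thetaC r ((Φ N).flow s z) x) (uC r ((Φ N).flow s z) x) v|})
      (Sum.elim
        (fun kl : Fin 3 × Fin 3 => {z : Phase N | εP < ∫ t₀ in Set.Icc 0 (t + 1), ∫ x₀,
          |collisionSum σ N (Φ N) (t + 1) (fun p => r⁻¹ * max (1 - |p.1 - t₀| / r) 0 * cone r p.2 x₀) gc
              𝒯[L, kl.1, kl.2] r z -
            σ ^ 3 * ∫ s in Set.Icc 0 (t + 1), r⁻¹ * max (1 - |s - t₀| / r) 0 * ∫ x, cone r x x₀ *
              (gc (σ ^ 3 * rhoC r ((Φ N).flow s z) x) * contactValue (σ ^ 3 * rhoC r ((Φ N).flow s z) x) *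
                pairFunctional r 𝒯[L, kl.1, kl.2] ((Φ N).flow s z) x)|})
        (fun b : Bool => cond b
          {z : Phase N | εPl < ∫ t₀ in Set.Icc 0 (t + 1), ∫ x₀,
            |collisionSum σ N (Φ N) (t + 1) (fun p => r⁻¹ * max (1 - |p.1 - t₀| / r) 0 * cone r p.2 x₀)
                (fun b => |gc b|) ℬ[L] r z -
              σ ^ 3 * ∫ s in Set.Icc 0 (t + 1), r⁻¹ * max (1 - |s - t₀| / r) 0 * ∫ x, cone r x x₀ *
                ((fun b => |gc b|) (σ ^ 3 * rhoC r ((Φ N).flow s z) x) *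
                  contactValue (σ ^ 3 * rhoC r ((Φ N).flow s z) x) * pairFunctional r ℬ[L] ((Φ N).flow s z) x)|}
          {z : Phase N | εC < hsDiameter σ N / (N + 1 : ℝ) *
            ∑ᶠ (s : ℝ) (_ : s ∈ collisionTimes (Torus.geometry (Fin 3)) (hsDiameter σ N) (fun s => (Φ N).flow s z) ∩
              Set.Icc 0 (t + 1)), ∑ i : Fin (N + 1), ∑ j : Fin (N + 1),
              (if i ≠ j ∧ ‖(Torus.geometry (Fin 3)).sepVec ((Φ N).flow s z i).1 ((Φ N).flow s z j).1‖ =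
                  hsDiameter σ N then
                (if L_C < ‖((Φ N).flow s z i).2‖ ^ 2 + ‖((Φ N).flow s z j).2‖ ^ 2 then
                  1 + ‖((Φ N).flow s z i).2‖ ^ 2 + ‖((Φ N).flow s z j).2‖ ^ 2 else 0) else 0)})))
    (localGibbsLaw_compl_good_eq_zero (Φ N)) hSen hStail hSE (by
      rintro (jk | kl | b)
      · exact HNJ jk N (hNJ jk)
      · exact HNK kl N (hNK kl)
      · cases b
        · exact hCM' N hN₀C
        · exact HNL N hNL) (fun z hz h1 h2 h3 h4 => by
      have hzg : z ∈ (Φ N).good := Set.notMem_compl_iff.1 hz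
      simp only [Set.mem_setOf_eq, not_lt] at h1 h2 h3 ⊢
      have hKz : ke z ≤ K := by
        rw [ke_eq_configEnergy, Nat.cast_succ, ← (Φ N).configEnergy_flow hzg 0]; exact h1
      have hκz : ∫ s in Set.Icc 0 t, ((N : ℝ) + 1)⁻¹ * ∑ i, cubeTail L (((Φ N).flow s z) i).2 ≤ κ := by
        rwa [intervalIntegral.integral_of_le ht, ← integral_Icc_eq_integral_Ioc] at h2
      have hJz : ∀ j k : Fin 3, ∫ s in Set.Icc 0 t, ∫ x,
          |hW (rhoC r ((Φ N).flow s z) x, uC r ((Φ N).flow s z) x, thetaC r ((Φ N).flow s z) x)| *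
            |MpsiC r ((Φ N).flow s z) x (psiJK L j k) - rhoC r ((Φ N).flow s z) x *
              ∫ v, psiJK L j k v * localMaxwellian 1 (thetaC r ((Φ N).flow s z) x) (uC r ((Φ N).flow s z) x) v| ≤
          η' := fun j k => by
        have h5 := h4 (Sum.inl (j, k))
        simp only [Sum.elim_inl, Set.mem_setOf_eq, not_lt] at h5
        exact h5
      have hKz' : ∀ k l : Fin 3, ∫ t₀ in Set.Icc 0 (t + 1), ∫ x₀,
          |collisionSum σ N (Φ N) (t + 1) (fun p => r⁻¹ * max (1 - |p.1 - t₀| / r) 0 * cone r p.2 x₀) gc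
              𝒯[L, k, l] r z -
            σ ^ 3 * ∫ s in Set.Icc 0 (t + 1), r⁻¹ * max (1 - |s - t₀| / r) 0 * ∫ x, cone r x x₀ *
              (gc (σ ^ 3 * rhoC r ((Φ N).flow s z) x) * contactValue (σ ^ 3 * rhoC r ((Φ N).flow s z) x) *
                pairFunctional r 𝒯[L, k, l] ((Φ N).flow s z) x)| ≤ εP := fun k l => by
        have h5 := h4 (Sum.inr (Sum.inl (k, l)))
        simp only [Sum.elim_inr, Sum.elim_inl, Set.mem_setOf_eq, not_lt] at h5
        exact h5
      have hLz := h4 (Sum.inr (Sum.inr true))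
      simp only [Sum.elim_inr, cond_true, Set.mem_setOf_eq, not_lt] at hLz
      have hCz := h4 (Sum.inr (Sum.inr false))
      simp only [Sum.elim_inr, cond_false, Set.mem_setOf_eq, not_lt] at hCz
      simp only [hWh] at hJz h3
      have hCMz : collisionSum σ N (Φ N) t (fun _ => 1) (fun _ => 1)
          (fun q => if L ^ 2 < ‖q.2.1‖ ^ 2 + ‖q.2.2‖ ^ 2 then 1 + ‖q.2.1‖ ^ 2 + ‖q.2.2‖ ^ 2 else 0) r z ≤ εC := by
        rw [cmuiSum_eq (Φ N) (t + 1) r L_C z] at hCz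
        refine le_trans ?_ hCz
        have hnn : ∀ (M : ℝ) (q : V3 × V3 × V3),
            0 ≤ (if M < ‖q.2.1‖ ^ 2 + ‖q.2.2‖ ^ 2 then 1 + ‖q.2.1‖ ^ 2 + ‖q.2.2‖ ^ 2 else (0 : ℝ)) := by
          intro M q; split_ifs <;> positivity
        calc collisionSum σ N (Φ N) t (fun _ => 1) (fun _ => 1)
              (fun q => if L ^ 2 < ‖q.2.1‖ ^ 2 + ‖q.2.2‖ ^ 2 then 1 + ‖q.2.1‖ ^ 2 + ‖q.2.2‖ ^ 2 else 0) r z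
            = collisionSum σ N (Φ N) (t + 1) (fun p => if p.1 ≤ t then (1 : ℝ) else 0) (fun _ => 1)
              (fun q => if L ^ 2 < ‖q.2.1‖ ^ 2 + ‖q.2.2‖ ^ 2 then 1 + ‖q.2.1‖ ^ 2 + ‖q.2.2‖ ^ 2 else 0) r z :=
              (collisionSum_indicator (Φ N) hzg (by linarith) _ _ _ r).symm
          _ ≤ collisionSum σ N (Φ N) (t + 1) (fun _ => 1) (fun _ => 1)
              (fun q => if L ^ 2 < ‖q.2.1‖ ^ 2 + ‖q.2.2‖ ^ 2 then 1 + ‖q.2.1‖ ^ 2 + ‖q.2.2‖ ^ 2 else 0) r z :=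
              collisionSum_mono (Φ N) hzg hσ r (fun s _ x => by dsimp only; split_ifs <;> norm_num)
                (fun _ => zero_le_one) (hnn _)
          _ ≤ _ := collisionSum_mark_mono (Φ N) hzg hσ r (fun s _ x => zero_le_one) (fun _ => zero_le_one) (hnn _)
              (fun q _ => by
                by_cases hq : L ^ 2 < ‖q.2.1‖ ^ 2 + ‖q.2.2‖ ^ 2
                · rw [if_pos hq, if_pos (hLC.trans_lt hq)]
                · rw [if_neg hq]; exact hnn _ q)
      have core := pathwise_core (Φ N) hMM hzg hσ hr hr2 hL1 ht
        (fun k l p => a k l (min (max p.1 0) (t + 1), p.2)) hacc hA hω0.le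
        (fun k l s t₀ x x₀ hs hx => hd k l s t₀ x x₀ (hs.trans hrd) (hx.trans hrd))
        hgcc hYt hη₀ hgb hgY hgc0 hYeq hη₀Y hρ₁0 hθ₁0 hΘ0 hU0 hKz hCMz hKz' hLz hκz hJz h3
      have hbudget := budget_le (L := L) (θ₁ := θ₁) (ρ₁ := ρ₁) (Θ := Θ) (U := U) (κ := κ) (η' := η')
        hη ht hA0 hGb0 hCgY0 hη₀.le hK0 hr2.le hω0.le hω1 hεC hεP hεPl hωb hωb' hrb hrb' h6 hκ
      have e1 : ∀ k l, collisionSum σ N (Φ N) t (fun p => a k l (min (max p.1 0) (t + 1), p.2)) gc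
          (fun q => |⟪q.2.1 - q.2.2, q.1⟫_ℝ| * (q.1 k * q.1 l)) r z =
          collisionSum σ N (Φ N) t (a k l) g (fun q => |⟪q.2.1 - q.2.2, q.1⟫_ℝ| * (q.1 k * q.1 l)) r z :=
        fun k l => collisionSum_congr (Φ N) hzg hσ.le hr _
          (fun s hs x => haceq k l s ⟨hs.1, hs.2.trans (by linarith)⟩ x) hgcnn
      have e3 : ∫ s in Set.Icc 0 t, ∫ x, gc (σ ^ 3 * rhoC r ((Φ N).flow s z) x) * pexC σ r ((Φ N).flow s z) x *
          ∑ k : Fin 3, a k k (min (max s 0) (t + 1), x) =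
          ∫ s in Set.Icc 0 t, ∫ x, g (σ ^ 3 * rhoC r ((Φ N).flow s z) x) * pexC σ r ((Φ N).flow s z) x *
            ∑ k : Fin 3, a k k (s, x) := by
        refine setIntegral_congr_fun measurableSet_Icc fun s hs => ?_
        show (∫ x, gc (σ ^ 3 * rhoC r ((Φ N).flow s z) x) * pexC σ r ((Φ N).flow s z) x *
          ∑ k : Fin 3, a k k (min (max s 0) (t + 1), x)) = _
        congr 1
        funext x
        rw [hgcnn _ (mul_nonneg (pow_nonneg hσ.le 3) (rhoC_nonneg hr _ _))]
        congr 1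
        exact Finset.sum_congr rfl fun k _ => haceq k k s ⟨hs.1, hs.2.trans (by linarith)⟩ x
      have key := congrArg₂ (fun u v : ℝ => |u - 2 * v|)
        (Finset.sum_congr rfl fun k (_ : k ∈ (Finset.univ : Finset (Fin 3))) =>
          Finset.sum_congr rfl fun l (_ : l ∈ (Finset.univ : Finset (Fin 3))) => e1 k l) e3
      beta_reduce at key
      rw [pressureSum_eq (Φ N) hzg t r a g, ← key]
      exact core.trans hbudget)).trans_eq ?_
  have hcard : (3 + (Fintype.card ((Fin 3 × Fin 3) ⊕ ((Fin 3 × Fin 3) ⊕ Bool)) : ℝ)) * (δ / 23) = δ := by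
    simp only [Fintype.card_sum, Fintype.card_prod, Fintype.card_fin, Fintype.card_bool]; push_cast; ring
  rw [hcard]

/-! ## Registered sub-goal -/

/-- **Registered sub-goal `stub_pressureValueO` (helper O of `stub_pressureValueOfEnskog`): the count of the bad
events.** [folklore] -/
theorem stub_pressureValueO : ∀ (δ : ℝ), (3 + (Fintype.card ((Fin 3 × Fin 3) ⊕ ((Fin 3 × Fin 3) ⊕ Bool)) : ℝ)) * (δ / 23) = δ := by
  intro δ
  simp only [Fintype.card_sum, Fintype.card_prod, Fintype.card_fin, Fintype.card_bool]; push_cast; ring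

end InProbability

end Summit.AtomisticToContinuum.HydrodynamicLimit.Theorems.ChaosClosesEulerPressureValue

end
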